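import Summits.QuantumAdvantage.QuantumAdvantage.Theorems.LinnikCubicClassGroupsDegreeOnePrimesEscapeHeckeSmoothed
import Summits.QuantumAdvantage.QuantumAdvantage.Theorems.LinnikCubicClassGroupsDegreeOnePrimesEscapeClassPNTDHSmoothed
import Literature.NumberTheory.LFunctions.RayClassLSeriesLogDerivLeft
import HarnessLib

/-!
# The Deuring-twisted smoothed explicit formula of a cyclic extension `N|E`: preliminaries

Topic `Summits/QuantumAdvantage/QuantumAdvantage/Theorems`, cell B2b-1 (linnik-cubic), PART A (gen 12);
helper toward the crux `DegreeOnePrimesEscape` (stmt-QuantumAdvantage-11543) of route `LinnikCubicClassGroups`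
— step M5 (analytic core) of the Lagarias–Montgomery–Odlyzko theorem for conjugacy classes inside a division
(LMO-PLAN).  HONEST FRAMING: the value of this file is a THEOREM (kernel-checked) — NOT summit progress.

Setting: `N|E` finite cyclic of degree `m`, `1 < [E:ℚ]`, `[N:ℚ] = n`; Hecke characters `χ_j mod 𝔣_j`
(`0 ≤ j < m`, `χ_0 = 1 mod (1)`), primitive for `0 < j < m` with entire continuations `L_j, L̄_j`, conductors
`|d_E| 𝔑𝔣_j ≤ |d_N|`, and `ord_ρ ζ₁_N = ord_ρ ζ₁_E + Σ_{0<j<m} ord_ρ L_j` (the data of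
`Literature.NumberTheory.LFunctions.CyclicExtension.exists_primitive_heckeFactorisation`).  For `|c| ≤ 1` put
`S_c(g) = Σ_{j<m} c^j K_j(g)`, `K_j(g) = Σ_n Λ_{χ_j}(n) g(log n)`; with `c = χ₁(τ)^{-1}` this is `m` times the
smoothed count of prime powers `𝔭^k` of `E` with `Frob_𝔭^k = τ` (`…DeuringCoefficients.lean`).

This file: preliminaries (the trivial character `Λ_{𝟙 mod (1)} = Λ_{χ_triv}`, the per-character inequality with the
zero-sum hypothesis over the zeros of `L` only, the numerics of the junk terms, domination of orders ⇒ zeros);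
the core estimate `deuringSum_core` is in `…DeuringSmoothedCore.lean` and the dichotomy in `…DeuringSmoothed.lean`.
**Theorem** (`deuringSum_dichotomy_dh`, there).  For `n > 1`, density constants `b, D, a` and `η > 0` (and the
Deuring–Heilbronn phenomenon `hDH`, the statement of `deuringHeilbronn`) there are `ν, a₁, c` such that for all
such data obeying the log-free density bound for the class-group family of `N`, with `Q = condQn N`,
`g_x = tzTest (log x) x^{−ν}`, `F` its Laplace transform, for all `x ≥ Q^{a₁}` and `|c| ≤ 1`:
EITHER `ζ₁_N` has no real zero in `(1 − c/(log|d_N| + log 4), 1)` and `‖S_c(g_x) − F(−1)‖ ≤ η x`; OR `β₁` is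
such a zero (unique, simple), carried by exactly one factor `j₀` (`ζ₁_E` if `j₀ = 0`, else `L_{j₀}`), and
`‖S_c(g_x) − F(−1) + c^{j₀} F(−β₁)‖ ≤ η x min(1, (1 − β₁) log x)`.

Proof: each `K_j` is read two-sidedly (`norm_coefFordK_rcCoef_add_exc_le'` for `j > 0`,
`norm_coefFordK_famF_sub_le` at `ψ = 0` for `ζ₁_E`), with zero sums dominated by the zero sum of the single
function `ζ₁_N = F_0` of the class-group family of `N` (`fam_zeroSum_le_local_zfr`), Landau–Page for `ζ₁_N`
(`exists_exceptionalZero_const`), Deuring–Heilbronn (`zfr_of_zeroRepulsion`), Stark's effective bound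
(`Residue.one_sub_realZero_ge_condQn_rpow`), and the numerics of `…ClassPNTDHNumerics`.
References: [LagariasMontgomeryOdlyzko1979, §§3, 7]; [ThornerZaman2019, Thm. 1.4, §5]; [Weiss1983].
-/

noncomputable section

open Complex Real MeasureTheory Set Filter Topology NumberField NumberField.InfinitePlace IsDedekindDomain
open scoped NumberField nonZeroDivisors

namespace Summit.QuantumAdvantage.QuantumAdvantage.Theorems.DegreeOnePrimesEscape

open Literature.NumberTheory.LFunctions Literature.NumberTheory.LFunctions.NumberField
  Literature.NumberTheory.LFunctions.EntireEF Literature.NumberTheory.LFunctions.TZWeight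
  Literature.NumberTheory.LFunctions.AbelianDensity

/-! ### The trivial character: `Λ_{𝟙 mod (1)} = Λ_{χ_triv}` -/

/-- The ray class coefficient of the trivial character modulo `(1)` is the class-group twist by the trivial
character: both are `1` on nonzero ideals and `0` at `0`. -/
theorem rayClassCoeffHom_top_one_eq {E : Type} [Field E] [NumberField E] (I : Ideal (𝓞 E)) :
    rayClassCoeffHom (⊤ : Ideal (𝓞 E)) (fun _ ↦ (1 : ℂ)) I =
      classGroupCharIdealHom (toMulHom (0 : AddChar (Additive (ClassGroup (𝓞 E))) ℂ)).toHomUnits I := by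
  classical
  by_cases hI : I = ⊥
  · rw [hI, ← Ideal.zero_eq_bot, map_zero, map_zero]
  · have hcop : IsCoprime I (⊤ : Ideal (𝓞 E)) := by rw [← Ideal.one_eq_top]; exact isCoprime_one_right
    have h1 : idealPow E (fun _ ↦ (1 : ℂ)) I = 1 := by
      unfold idealPow
      exact finprod_eq_one_of_forall_eq_one fun v ↦ one_pow _
    rw [rayClassCoeffHom_apply, rayClassCoeff, if_pos ⟨hI, hcop⟩, h1, classGroupCharIdealHom_apply_of_ne_bot _ hI,
      toHomUnits_toMulHom_zero, MonoidHom.one_apply, Units.val_one]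

/-- Hence `rcCoef (1) 𝟙 = cgCoef χ_triv`. -/
theorem rcCoef_top_one_eq {E : Type} [Field E] [NumberField E] :
    rcCoef (⊤ : Ideal (𝓞 E)) (fun _ ↦ (1 : ℂ)) =
      cgCoef (toMulHom (0 : AddChar (Additive (ClassGroup (𝓞 E))) ℂ)).toHomUnits := by
  funext n
  simp only [rcCoef, cgCoef, NumberField.twistVonMangoldt]
  exact Finset.sum_congr rfl fun I _ ↦ by rw [rayClassCoeffHom_top_one_eq]


/-! ### The per-character inequality with the zero-sum hypothesis over the zeros of `L` only -/

section PerCharacter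

variable {K : Type} [Field K] [NumberField K]
variable {𝔪 : Ideal (𝓞 K)} {ψ : HeightOneSpectrum (𝓞 K) → ℂ} {p : Finset {w : InfinitePlace K // IsReal w}}

/-- **The smoothed explicit inequality for a primitive Hecke character dominated by `ζ₁_N`, zero-sum
hypothesis over the zeros of `L` only** (twin of `norm_coefFordK_rcCoef_add_exc_le`): the bound `B` is only
required for the finite partial sums `Σ_{ρ ∉ Exc} m_{ζ₁_N}(ρ)‖F(−ρ)‖` over non-trivial ZEROS OF `L`.
[cite: LagariasMontgomeryOdlyzko1979, §7] [cite: ThornerZaman2019, Lemma 4.3] -/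
theorem norm_coefFordK_rcCoef_add_exc_le_of_zeros (hψ : IsRayClassCharacter 𝔪 ψ) (hprim : IsPrimitive 𝔪 ψ)
    (hp : IsSignType 𝔪 ψ p) (h𝔪 : 𝔪 ≠ ⊥)
    (hnt : ∃ v : HeightOneSpectrum (𝓞 K), ¬ 𝔪 ≤ v.asIdeal ∧ ψ v ≠ 1)
    {L L' : ℂ → ℂ} (hL : Differentiable ℂ L) (hLs : ∀ s : ℂ, 1 < s.re → L s = rayClassLSeries 𝔪 ψ s)
    (hL' : Differentiable ℂ L') (hL's : ∀ s : ℂ, 1 < s.re → L' s = rayClassLSeries 𝔪 (star ψ) s)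
    {N : Type} [Field N] [NumberField N]
    (hdom : ∀ ρ : ℂ, analyticOrderNatAt L ρ ≤ analyticOrderNatAt (dedekindZeta₁ N) ρ)
    {C : ℝ} (hC0 : 0 < C)
    (hC : ∀ (K : Type) [Field K] [NumberField K] (𝔪 : Ideal (𝓞 K))
      (ψ : HeightOneSpectrum (𝓞 K) → ℂ) (p : Finset {w : InfinitePlace K // IsReal w}),
      IsRayClassCharacter 𝔪 ψ → IsPrimitive 𝔪 ψ → IsSignType 𝔪 ψ p → 𝔪 ≠ ⊥ →
      ∀ (L L' : ℂ → ℂ), Differentiable ℂ L → (∀ s : ℂ, 1 < s.re → L s = rayClassLSeries 𝔪 ψ s) →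
        Differentiable ℂ L' → (∀ s : ℂ, 1 < s.re → L' s = rayClassLSeries 𝔪 (star ψ) s) →
      ∀ t : ℝ, ‖logDeriv L (-1 / 2 + t * I)‖ ≤
        C * (Module.finrank ℚ K + 1) * (Real.log (|(discr K : ℝ)| * (Ideal.absNorm 𝔪 : ℝ)) + Real.log (|t| + 4)))
    {M : ℝ} (hM : ∀ y : ℝ, |iteratedDeriv 1 Real.smoothTransition y| ≤ M ∧ |iteratedDeriv 2 Real.smoothTransition y| ≤ M)
    {x ε : ℝ} (hx : 1 < x) (hε : 0 < ε) (hεL : ε < Real.log x / 2)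
    (Exc : Finset ℂ) (hExc : ∀ ρ ∈ Exc, L ρ = 0 ∧ 0 < ρ.re ∧ ρ.re < 1)
    {B : ℝ} (hB : ∀ u : Finset ℂ, (∀ ρ ∈ u, L ρ = 0 ∧ 0 < ρ.re ∧ ρ.re < 1) →
      ∑ ρ ∈ u with ρ ∉ Exc, (analyticOrderNatAt (dedekindZeta₁ N) ρ : ℝ) *
        ‖fordLaplace (tzTest (Real.log x) ε) (-ρ)‖ ≤ B) :
    ‖coefFordK (rcCoef 𝔪 ψ) (tzTest (Real.log x) ε) 0 +
        ∑ ρ ∈ Exc, (analyticOrderNatAt L ρ : ℂ) * fordLaplace (tzTest (Real.log x) ε) (-ρ)‖ ≤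
      B + 8 * (Real.log (|(discr K : ℝ)| * (Ideal.absNorm 𝔪 : ℝ)) + 6 * Module.finrank ℚ K) * (Real.log x + ε) +
        NumberField.leftLineConst * (C * (Module.finrank ℚ K + 1)) *
          (Real.log (|(discr K : ℝ)| * (Ideal.absNorm 𝔪 : ℝ)) + Real.log 4 + 1) *
          (Real.exp (-(Real.log x / 4) + ε / 2) * (2 * M / ε)) := by
  classical
  set Lx := Real.log x with hLx
  have hLpos : 0 < Lx := Real.log_pos hx
  have hadm := isSmoothedEFTest_tzTest hLpos hε
  have hg0 : tzTest Lx ε 0 = 0 := tzTest_zero hLpos hε hεL.le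
  have hF0 : ‖fordLaplace₀ (tzTest Lx ε) 0‖ ≤ Lx + ε := by
    rw [fordLaplace₀_eq_fordLaplace hg0]; exact norm_fordLaplace_tzTest_zero_le hLpos hε hεL
  have hsz : ∀ ρ : ℂ, L ρ = 0 → 0 < ρ.re → ρ.re < 1 → ρ ≠ 0 := by
    intro ρ _ h1 _ h; rw [h] at h1; simp at h1
  have hexpl := rcCoefFordK_eq_explicit hψ hprim hp h𝔪 hnt hL hLs hL' hL's hadm hg0 (s := 0)
    (by norm_num) (by norm_num) hsz
  have hsum := summable_norm_rcZeroTerm hψ hprim hp h𝔪 hnt hL hLs hL' hL's hadm (s := 0) (by norm_num) hsz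
  have hB' : ∀ u : Finset ℂ, (∀ ρ ∈ u, L ρ = 0 ∧ 0 < ρ.re ∧ ρ.re < 1) →
      ∑ ρ ∈ u with ρ ∉ Exc, (analyticOrderNatAt L ρ : ℝ) * ‖fordLaplace (tzTest Lx ε) (-ρ)‖ ≤ B := by
    intro u hu
    refine le_trans (Finset.sum_le_sum fun ρ _ ↦ ?_) (hB u hu)
    exact mul_le_mul_of_nonneg_right (by exact_mod_cast hdom ρ) (norm_nonneg _)
  have hcore := norm_explicit_core (f := L) hg0 (Kv := coefFordK (rcCoef 𝔪 ψ) (tzTest Lx ε) 0) (main := 0)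
    (J := rcEFRemainder L (tzTest Lx ε) 0) hsum (by rw [hexpl]; ring) hF0 Exc hExc hB'
  rw [sub_zero] at hcore
  have hm₀ := analyticOrderNatAt_continuation_zero_le hψ hprim hp h𝔪 hnt hL hLs
  have hJ := norm_rcEFRemainder_tzTest_zero_le hC0 hC hψ hprim hp h𝔪 hnt hL hLs hL' hL's hM hLpos hε hεL
  have hlogA : 0 ≤ Real.log (|(discr K : ℝ)| * (Ideal.absNorm 𝔪 : ℝ)) := by
    refine Real.log_nonneg ?_
    have h1 : (1 : ℝ) ≤ |(discr K : ℝ)| := by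
      have := Int.one_le_abs (discr_ne_zero K)
      rw [← Int.cast_abs]; exact_mod_cast this
    have h2 : (1 : ℝ) ≤ (Ideal.absNorm 𝔪 : ℝ) := by
      exact_mod_cast Nat.one_le_iff_ne_zero.mpr (by rwa [ne_eq, Ideal.absNorm_eq_zero_iff])
    nlinarith
  have hm₀' : (analyticOrderNatAt L 0 : ℝ) * (Lx + ε) ≤
      8 * (Real.log (|(discr K : ℝ)| * (Ideal.absNorm 𝔪 : ℝ)) + 6 * Module.finrank ℚ K) * (Lx + ε) :=
    mul_le_mul_of_nonneg_right hm₀ (by linarith)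
  linarith

end PerCharacter

/-! ### Numerics of the per-character junk terms -/

/-- The trivial-zero term of a Hecke character of `E ⊆ N`: `8(log A + 6 n_E)(L + ε) ≤ 1152 e^{L/4}` when
`log A ≤ Q − 1`, `n_E ≤ Q`, `Q ≤ e^{L/8}`, `0 ≤ ε ≤ 1 ≤ L`. -/
theorem rayClass_trivialZero_junk_le {lA nE Q L ε : ℝ} (hlA0 : 0 ≤ lA) (hlA : lA ≤ Q - 1) (hnE : nE ≤ Q)
    (hQexp : Q ≤ Real.exp (L / 8)) (hL : 1 ≤ L) (hε0 : 0 ≤ ε) (hε1 : ε ≤ 1) :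
    8 * (lA + 6 * nE) * (L + ε) ≤ 1152 * Real.exp (L / 4) := by
  have h1 : 8 * (lA + 6 * nE) ≤ 56 * Q := by linarith
  have h2 : L + ε ≤ 2 * L := by linarith
  have h3 : 8 * (lA + 6 * nE) * (L + ε) ≤ 56 * Q * (2 * L) :=
    mul_le_mul h1 h2 (by linarith) (by nlinarith)
  have hL8 := le_eight_mul_exp_div L
  have hee : Real.exp (L / 8) * Real.exp (L / 8) = Real.exp (L / 4) := by rw [← Real.exp_add]; ring_nf
  have h4 : Q * L ≤ Real.exp (L / 8) * (8 * Real.exp (L / 8)) :=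
    mul_le_mul hQexp hL8 (by linarith) (Real.exp_pos _).le
  nlinarith [Real.exp_pos (L / 8)]

/-- The left-line term of a Hecke character of `E ⊆ N`:
`leftLineConst · C(n_E+1)(log A + log 4 + 1) e^{−L/4+ε/2}(2M/ε) ≤ 8 leftLineConst C (n₀+1) M` when
`log A ≤ Q − 1`, `n_E ≤ n₀`, `Q ≤ e^{L/8}`, `ε = e^{−νL}`, `ν ≤ 1/64`, `0 < ε ≤ 1`, `0 < L`. -/
theorem rayClass_leftLine_junk_le {C M lA nE n₀ Q L ε ν : ℝ} (hC : 0 < C) (hM : 0 ≤ M) (hlA0 : 0 ≤ lA)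
    (hlA : lA ≤ Q - 1) (hnE : nE ≤ n₀) (hnE0 : 0 ≤ nE) (hQ12 : 12 ≤ Q) (hQexp : Q ≤ Real.exp (L / 8))
    (hL : 0 < L) (hε : 0 < ε) (hε1 : ε ≤ 1) (hν64 : ν ≤ 1 / 64) (hεexp : ε = Real.exp (-(ν * L))) :
    NumberField.leftLineConst * (C * (nE + 1)) * (lA + Real.log 4 + 1) * (Real.exp (-(L / 4) + ε / 2) * (2 * M / ε)) ≤
      8 * NumberField.leftLineConst * C * (n₀ + 1) * M := by
  have hlC := leftLineConst_nonneg
  have hlogd4 : lA + Real.log 4 + 1 ≤ 2 * Q := by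
    have hlog4 : Real.log 4 ≤ 2 := by
      have : Real.log 4 = 2 * Real.log 2 := by
        rw [show (4:ℝ) = 2 ^ 2 by norm_num, Real.log_pow]; norm_num
      rw [this]; have := Real.log_two_lt_d9; linarith
    linarith
  have hexp1 : Real.exp (-(L / 4) + ε / 2) ≤ 2 * Real.exp (-(L / 4)) := by
    rw [Real.exp_add, mul_comm]
    refine mul_le_mul_of_nonneg_right ?_ (Real.exp_pos _).le
    have hsq : Real.exp (ε / 2) ^ 2 < 2 ^ 2 := by
      rw [← Real.exp_nat_mul]
      have h1 : Real.exp ((2 : ℕ) * (ε / 2)) ≤ Real.exp 1 := Real.exp_le_exp.2 (by push_cast; linarith)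
      have := Real.exp_one_lt_d9; linarith
    exact (lt_of_pow_lt_pow_left₀ 2 (by norm_num) hsq).le
  have hexp2 : 2 * M / ε ≤ 2 * M * Real.exp (L / 64) := by
    rw [hεexp, div_eq_mul_inv, ← Real.exp_neg, neg_neg]
    refine mul_le_mul_of_nonneg_left (Real.exp_le_exp.2 ?_) (by positivity)
    nlinarith
  have hlog40 : 0 ≤ Real.log 4 := Real.log_nonneg (by norm_num)
  have hprod : (lA + Real.log 4 + 1) * (Real.exp (-(L / 4) + ε / 2) * (2 * M / ε)) ≤ 8 * M := by
    calc (lA + Real.log 4 + 1) * (Real.exp (-(L / 4) + ε / 2) * (2 * M / ε))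
        ≤ (2 * Q) * ((2 * Real.exp (-(L / 4))) * (2 * M * Real.exp (L / 64))) :=
          mul_le_mul hlogd4 (mul_le_mul hexp1 hexp2 (by positivity) (by positivity)) (by positivity) (by positivity)
      _ ≤ (2 * Real.exp (L / 8)) * ((2 * Real.exp (-(L / 4))) * (2 * M * Real.exp (L / 64))) :=
          mul_le_mul_of_nonneg_right (by linarith) (by positivity)
      _ = 8 * M * Real.exp (L / 8 + -(L / 4) + L / 64) := by rw [Real.exp_add, Real.exp_add]; ring
      _ ≤ 8 * M * 1 := by
          refine mul_le_mul_of_nonneg_left ?_ (by positivity)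
          rw [Real.exp_le_one_iff]; nlinarith
      _ = 8 * M := mul_one _
  have hn1 : C * (nE + 1) ≤ C * (n₀ + 1) := mul_le_mul_of_nonneg_left (by linarith) hC.le
  calc NumberField.leftLineConst * (C * (nE + 1)) * (lA + Real.log 4 + 1) * (Real.exp (-(L / 4) + ε / 2) * (2 * M / ε))
      = NumberField.leftLineConst * (C * (nE + 1)) * ((lA + Real.log 4 + 1) * (Real.exp (-(L / 4) + ε / 2) * (2 * M / ε))) := by
        ring
    _ ≤ NumberField.leftLineConst * (C * (n₀ + 1)) * (8 * M) :=
        mul_le_mul (mul_le_mul_of_nonneg_left hn1 hlC) hprod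
          (mul_nonneg (by linarith) (by positivity)) (mul_nonneg hlC (mul_nonneg hC.le (by linarith)))
    _ = _ := by ring


/-! ### Domination and zeros -/

/-- If `ord_ρ f ≤ ord_ρ g` everywhere for entire `f, g` with `f(2) ≠ 0`, then every zero of `f` is a zero of `g`. -/
theorem eq_zero_of_analyticOrderNatAt_le {f g : ℂ → ℂ} (hf : Differentiable ℂ f) (hg : Differentiable ℂ g)
    (hf2 : f 2 ≠ 0) (hdom : ∀ ρ, analyticOrderNatAt f ρ ≤ analyticOrderNatAt g ρ) {ρ : ℂ} (h0 : f ρ = 0) :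
    g ρ = 0 := by
  have htop : analyticOrderAt f ρ ≠ ⊤ := by
    intro htop
    rw [analyticOrderAt_eq_top] at htop
    exact hf2 (((hf.differentiableOn.analyticOnNhd isOpen_univ).eqOn_zero_of_preconnected_of_eventuallyEq_zero
      isPreconnected_univ (Set.mem_univ ρ) htop) (Set.mem_univ (2 : ℂ)))
  have hpos : 0 < analyticOrderNatAt f ρ := by
    by_contra h
    push Not at h
    have h0' : analyticOrderNatAt f ρ = 0 := Nat.le_zero.mp h
    have : analyticOrderAt f ρ = 0 := by
      have := ENat.coe_toNat htop
      rw [analyticOrderNatAt] at h0'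
      rw [← this, h0']; rfl
    rw [(hf.analyticAt ρ).analyticOrderAt_eq_zero] at this
    exact this h0
  have hN0 : 0 < analyticOrderNatAt g ρ := lt_of_lt_of_le hpos (hdom ρ)
  by_contra hne
  have : analyticOrderAt g ρ = 0 := by rw [(hg.analyticAt ρ).analyticOrderAt_eq_zero]; exact hne
  have : analyticOrderNatAt g ρ = 0 := by rw [analyticOrderNatAt, this]; rfl
  omega

end Summit.QuantumAdvantage.QuantumAdvantage.Theorems.DegreeOnePrimesEscape
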